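import Summits.MatrixMultiplication.MatrixMultiplication.Theorems.FarEdgeDescentSpecialLevel
import HarnessLib

/-!
# Far-edge descent, Kernel XI-e — on the special class every spectral value is a monotone
# function of the SUPPORT

Support for `Summit.MatrixMultiplication.MatrixMultiplication.Theses.FarEdgeDescent`
(aside `SubLogRate`; lens «structural dichotomy (special vs generic)», generation 36).

`V_S = {T : supp T ⊆ supp 𝔖(1)}` is the support class of `⟨2,2,2⟩` (`𝔖(q) = fam K q`).  X-d /
XI-b split it into GENERIC members (full support: torus translates of `𝔖(q)`, `q ≠ 0` a
CONTINUOUS invariant) and SPECIAL members (a support entry vanishes).  Here: the special half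
is DISCRETE:
* (§1–§2) **normal form** `T = (α ⊗ β ⊗ γ) · 𝟙_{supp T}`, `α, β, γ` nowhere zero, for every
  special `T` (`exists_scale_ind`): BCZ Lemma 3 at the deleted entry (XI-b), transported to all
  eight entries by the symmetries of `𝔖(1)`, then to every proper sub-support;
* (§3) so on the special class EVERY universal spectral point (and `R̃`) is a function of the
  support alone, with finitely many values (`spectralPoint_eq_of_support_iff`,
  `spectral_special_values_finite`) — every field;
* (§4) over an infinite field that function is **MONOTONE in the support**
  (`spectralPoint_mono_support`, `asymptoticRank_mono_support`, lattice form
  `spectralPoint_indOf_mono`) — Zariski density of the torus orbit in `K^{supp T'}` plus the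
  closed sublevel sets of `Φ` (CHNVZ); its top is the corank-one level `s = Φ(𝔖(0))` (XI-c).
Dichotomy on `V_S`: GENERIC = the line's values `Φ(𝔖(q))` (all-or-finite sublevels, X-b);
SPECIAL = a monotone set function on the proper sub-supports, maximum `s ∈ [r_gen − 1, r_gen]`.

## References

* M. Bläser, M. Christandl, J. Zuiddam, arXiv:1705.09652 (2017), Lemma 3. [BCZ17]
* M. Christandl, V. Hoeberechts, H. Nieuwboer, P. Vrana, J. Zuiddam, arXiv:2411.15789 (2025),
  Cor. 2.4, §3. [ChristandlHoeberechtsNieuwboerVranaZuiddam2025]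
* V. Strassen, J. reine angew. Math. 384 (1988), §2, Thm. 3.9. [Strassen1988]
-/

noncomputable section

open scoped BigOperators

set_option linter.dupNamespace false

namespace Summit.MatrixMultiplication.MatrixMultiplication.Theorems.FarEdgeDescentSupportLattice

open Literature.Computability.AlgebraicComplexity
open Summit.MatrixMultiplication.MatrixMultiplication.Theorems.FarEdgeDescentSignTwist
open Summit.MatrixMultiplication.MatrixMultiplication.Theorems.FarEdgeDescentSignTwistComm
open Summit.MatrixMultiplication.MatrixMultiplication.Theorems.FarEdgeDescentSignTwistCommPow
open Summit.MatrixMultiplication.MatrixMultiplication.Theorems.FarEdgeDescentSignTwistDet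
open Summit.MatrixMultiplication.MatrixMultiplication.Theorems.FarEdgeDescentWeightFamily
open Summit.MatrixMultiplication.MatrixMultiplication.Theorems.FarEdgeDescentRankOneCoupling
open Summit.MatrixMultiplication.MatrixMultiplication.Theorems.FarEdgeDescentSpectralSublevel
open Summit.MatrixMultiplication.MatrixMultiplication.Theorems.FarEdgeDescentSupportClass
open Summit.MatrixMultiplication.MatrixMultiplication.Theorems.FarEdgeDescentSpecialClass
open Summit.MatrixMultiplication.MatrixMultiplication.Theorems.FarEdgeDescentSpecialValue
open Summit.MatrixMultiplication.MatrixMultiplication.Theorems.FarEdgeDescentSpecialLevel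

section AnyField

variable {K : Type} [Field K]

/-! ## §1 Support indicators and the normal form at one deleted entry -/

open Classical in
/-- The support indicator `𝟙_{supp T}` (entries `1` where `T ≠ 0`, else `0`). [folklore] -/
def ind (T : Leaf2 → (Fin 2 × Fin 2) → Leaf2 → K) : Leaf2 → (Fin 2 × Fin 2) → Leaf2 → K :=
  fun a x c => if T a x c = 0 then 0 else 1

/-- `𝟙_{supp T} = 0` where `T = 0`. [folklore] -/
theorem ind_apply_of_eq_zero {T : Leaf2 → (Fin 2 × Fin 2) → Leaf2 → K} {a : Leaf2}
    {x : Fin 2 × Fin 2} {c : Leaf2} (h : T a x c = 0) : ind T a x c = 0 := by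
  simp [ind, h]

/-- `𝟙_{supp T} = 1` where `T ≠ 0`. [folklore] -/
theorem ind_apply_of_ne_zero {T : Leaf2 → (Fin 2 × Fin 2) → Leaf2 → K} {a : Leaf2}
    {x : Fin 2 × Fin 2} {c : Leaf2} (h : T a x c ≠ 0) : ind T a x c = 1 := by
  simp [ind, h]

/-- Tensors with the same support have the same indicator. [folklore] -/
theorem ind_eq_of_support_iff {T T' : Leaf2 → (Fin 2 × Fin 2) → Leaf2 → K}
    (h : ∀ a x c, T a x c = 0 ↔ T' a x c = 0) : ind T = ind T' := by
  funext a x c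
  by_cases hz : T a x c = 0
  · rw [ind_apply_of_eq_zero hz, ind_apply_of_eq_zero ((h a x c).1 hz)]
  · rw [ind_apply_of_ne_zero hz, ind_apply_of_ne_zero fun h' => hz ((h a x c).2 h')]

/-- The nonzero entries of `𝔖(0)` are `1`. [cite: BlaserChristandlZuiddam2017, Def. 5] -/
theorem fam_zero_eq_one_of_ne_zero {a : Leaf2} {x : Fin 2 × Fin 2} {c : Leaf2}
    (h : fam K 0 a x c ≠ 0) : fam K 0 a x c = 1 := by
  rw [fam_apply] at h ⊢
  by_cases hc : side a = side c ∧ x = (row a, row c)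
  · rw [if_pos hc] at h ⊢; simp only [wS, famW] at h ⊢
    split_ifs at h ⊢ <;> simp_all
  · exact absurd (if_neg hc) h

variable (K) in
/-- **Normal form at the entry `p`**: every member of the support class vanishing exactly at
`p` (among the support entries of `𝔖(1)`) is a torus translate of its support indicator.
[cite: BlaserChristandlZuiddam2017, Lemma 3] -/
def NFAt (p : Leaf2 × (Fin 2 × Fin 2) × Leaf2) : Prop :=
  ∀ T : Leaf2 → (Fin 2 × Fin 2) → Leaf2 → K,
    (∀ a x c, fam K 1 a x c = 0 → T a x c = 0) → T p.1 p.2.1 p.2.2 = 0 →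
      (∀ a x c, fam K 1 a x c ≠ 0 → (a, x, c) ≠ p → T a x c ≠ 0) →
        ∃ (α : Leaf2 → K) (β : Fin 2 × Fin 2 → K) (γ : Leaf2 → K),
          (∀ a, α a ≠ 0) ∧ (∀ b, β b ≠ 0) ∧ (∀ c, γ c ≠ 0) ∧
            T = fun a b c => α a * β b * γ c * ind T a b c

/-- The normal form at the deleted entry `p₀ = pt 1 1 0` (XI-b's `exists_scale_fam_zero`,
with `𝔖(0) = 𝟙_{supp T}`). [cite: BlaserChristandlZuiddam2017, Lemma 3] -/
theorem nfAt_p₀ : NFAt K (pt 1 1 0) := by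
  rw [pt_one_one_zero]
  intro T hT h0 hfull
  have hfull0 : ∀ a x c, fam K 0 a x c ≠ 0 → T a x c ≠ 0 := fun a x c hne =>
    hfull a x c (fun h1 => hne (fam_eq_zero_of_fam_one_eq_zero 0 h1)) fun heq => hne (by
      simp only [Prod.mk.injEq] at heq
      obtain ⟨rfl, rfl, rfl⟩ := heq
      exact fam_zero_p₀)
  obtain ⟨α, β, γ, hα, hβ, hγ, hEq⟩ := exists_scale_fam_zero hT h0 hfull0
  refine ⟨α, β, γ, hα, hβ, hγ, ?_⟩
  have hind : ind T = fam K 0 := by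
    funext a x c
    by_cases hz : fam K 0 a x c = 0
    · have hTz : T a x c = 0 := by
        rw [hEq]
        simp [hz]
      rw [ind_apply_of_eq_zero hTz, hz]
    · rw [ind_apply_of_ne_zero (hfull0 a x c hz), fam_zero_eq_one_of_ne_zero hz]
  rw [hind]
  exact hEq

/-- **Transport of normal forms** along a symmetry of `𝔖(1)`. [cite: Strassen1988, §2] -/
theorem nfAt_transport {e₁ e₃ : Leaf2 ≃ Leaf2} {e₂ : (Fin 2 × Fin 2) ≃ (Fin 2 × Fin 2)}
    (he : (fun a x c => fam K 1 (e₁ a) (e₂ x) (e₃ c)) = fam K 1)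
    {p : Leaf2 × (Fin 2 × Fin 2) × Leaf2} (H : NFAt K p) :
    NFAt K (e₁ p.1, e₂ p.2.1, e₃ p.2.2) := by
  intro T hT h0 hfull
  have he' : ∀ a x c, fam K 1 (e₁ a) (e₂ x) (e₃ c) = fam K 1 a x c := fun a x c =>
    congrFun (congrFun (congrFun he a) x) c
  have hT' : ∀ a x c, fam K 1 a x c = 0 → T (e₁ a) (e₂ x) (e₃ c) = 0 := fun a x c h =>
    hT _ _ _ (by rw [he']; exact h)
  have hfull' : ∀ a x c, fam K 1 a x c ≠ 0 → (a, x, c) ≠ p → T (e₁ a) (e₂ x) (e₃ c) ≠ 0 :=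
    fun a x c hne hp => hfull _ _ _ (by rw [he']; exact hne) fun heq => hp (by
      simp only [Prod.mk.injEq, EmbeddingLike.apply_eq_iff_eq] at heq
      exact Prod.ext heq.1 (Prod.ext heq.2.1 heq.2.2))
  obtain ⟨α, β, γ, hα, hβ, hγ, hEq⟩ := H (fun a x c => T (e₁ a) (e₂ x) (e₃ c)) hT' h0 hfull'
  refine ⟨fun a => α (e₁.symm a), fun b => β (e₂.symm b), fun c => γ (e₃.symm c),
    fun a => hα _, fun b => hβ _, fun c => hγ _, ?_⟩
  funext a b c
  have h := congrFun (congrFun (congrFun hEq (e₁.symm a)) (e₂.symm b)) (e₃.symm c)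
  have hi : ind (fun a x c => T (e₁ a) (e₂ x) (e₃ c)) =
      fun a x c => ind T (e₁ a) (e₂ x) (e₃ c) := rfl
  rw [hi] at h
  simpa only [Equiv.apply_symm_apply] using h

/-- Transport across the side swap. [folklore] -/
theorem nfAt_side {i k : Fin 2} (H : NFAt K (pt 1 i k)) : NFAt K (pt 0 i k) := by
  have h := nfAt_transport (fam_one_sideSwap (K := K)) H
  rwa [sideSwap_pt] at h

/-- Transport across the first row flip. [folklore] -/
theorem nfAt_row {σ k : Fin 2} (H : NFAt K (pt σ 1 k)) : NFAt K (pt σ 0 k) := by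
  have h := nfAt_transport (fam_one_flipRow (K := K)) H
  rwa [flipRow_pt] at h

/-- Transport across the second row flip. [folklore] -/
theorem nfAt_col {σ i : Fin 2} (H : NFAt K (pt σ i 0)) : NFAt K (pt σ i 1) := by
  have h := nfAt_transport (fam_one_flipCol (K := K)) H
  rwa [flipCol_pt] at h

/-- The normal form holds at every one of the eight support entries.
[cite: BlaserChristandlZuiddam2017, Lemma 3] -/
theorem nfAt_all : ∀ σ i k, NFAt K (pt σ i k) := by
  have b := nfAt_p₀ (K := K)
  intro σ i k
  fin_cases σ <;> fin_cases i <;> fin_cases k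
  · exact nfAt_side (nfAt_row b)
  · exact nfAt_side (nfAt_row (nfAt_col b))
  · exact nfAt_side b
  · exact nfAt_side (nfAt_col b)
  · exact nfAt_row b
  · exact nfAt_row (nfAt_col b)
  · exact b
  · exact nfAt_col b

/-! ## §2 Every special member is a torus translate of its support indicator -/

/-- **Normal form of the special class**: if `supp T ⊆ supp 𝔖(1)` and some support entry of
`𝔖(1)` vanishes in `T`, then `T = (α ⊗ β ⊗ γ) · 𝟙_{supp T}` with `α, β, γ` nowhere zero
(fill the other holes of `T` with `1`s, apply §1 at the chosen hole, compare on `supp T`).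
[cite: BlaserChristandlZuiddam2017, Lemma 3] -/
theorem exists_scale_ind {T : Leaf2 → (Fin 2 × Fin 2) → Leaf2 → K}
    (hT : ∀ a x c, fam K 1 a x c = 0 → T a x c = 0)
    (hz : ∃ a x c, fam K 1 a x c ≠ 0 ∧ T a x c = 0) :
    ∃ (α : Leaf2 → K) (β : Fin 2 × Fin 2 → K) (γ : Leaf2 → K),
      (∀ a, α a ≠ 0) ∧ (∀ b, β b ≠ 0) ∧ (∀ c, γ c ≠ 0) ∧
        T = fun a b c => α a * β b * γ c * ind T a b c := by
  classical
  obtain ⟨a₀, x₀, c₀, hne, h0⟩ := hz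
  obtain ⟨σ, i, k, hp⟩ := exists_pt_of_cond a₀ x₀ c₀ ((fam_one_ne_zero_iff a₀ x₀ c₀).1 hne)
  have H := nfAt_all (K := K) σ i k
  rw [← hp] at H
  set T' : Leaf2 → (Fin 2 × Fin 2) → Leaf2 → K := fun a x c =>
    if (a, x, c) = (a₀, x₀, c₀) then 0 else if T a x c = 0 ∧ fam K 1 a x c ≠ 0 then 1 else T a x c
    with hT'def
  have hT'S : ∀ a x c, fam K 1 a x c = 0 → T' a x c = 0 := fun a x c h => by
    simp only [hT'def]
    split_ifs with h1 h2
    · rfl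
    · exact absurd h h2.2
    · exact hT a x c h
  have hT'0 : T' (a₀, x₀, c₀).1 (a₀, x₀, c₀).2.1 (a₀, x₀, c₀).2.2 = 0 := by
    simp [hT'def]
  have hT'full : ∀ a x c, fam K 1 a x c ≠ 0 → (a, x, c) ≠ (a₀, x₀, c₀) → T' a x c ≠ 0 :=
    fun a x c hne' hp' => by
      simp only [hT'def, if_neg hp']
      split_ifs with h2
      · exact one_ne_zero
      · exact fun h => h2 ⟨h, hne'⟩
  obtain ⟨α, β, γ, hα, hβ, hγ, hEq⟩ := H T' hT'S hT'0 hT'full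
  refine ⟨α, β, γ, hα, hβ, hγ, funext fun a => funext fun b => funext fun c => ?_⟩
  by_cases hz : T a b c = 0
  · rw [hz, ind_apply_of_eq_zero hz, mul_zero]
  · have hne' : (a, b, c) ≠ (a₀, x₀, c₀) := fun heq => hz (by
      simp only [Prod.mk.injEq] at heq
      obtain ⟨rfl, rfl, rfl⟩ := heq
      exact h0)
    have h1 : T' a b c = T a b c := by
      simp only [hT'def, if_neg hne']
      rw [if_neg fun h => hz h.1]
    have h2 := congrFun (congrFun (congrFun hEq a) b) c
    have h3 : ind T' a b c = 1 := ind_apply_of_ne_zero (by rw [h1]; exact hz)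
    rw [h3, h1] at h2
    rw [ind_apply_of_ne_zero hz]
    exact h2

/-! ## §3 On the special class every spectral value is a function of the support -/

/-- **`Φ(T) = Φ(𝟙_{supp T})` for special `T`** and every universal spectral point `Φ`, every
field (torus invariance of spectral points, X-d).
[cite: BlaserChristandlZuiddam2017, Lemma 3] [cite: Strassen1988, §2] -/
theorem spectralPoint_eq_ind {Φ : SpectralMap K} (hΦ : IsUniversalSpectralPoint K Φ)
    {T : Leaf2 → (Fin 2 × Fin 2) → Leaf2 → K} (hT : IsSpecial T) : Φ T = Φ (ind T) := by
  obtain ⟨hsub, hz⟩ := hT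
  obtain ⟨α, β, γ, hα, hβ, hγ, hEq⟩ := exists_scale_ind hsub hz
  conv_lhs => rw [hEq]
  exact spectralPoint_scale_eq hΦ hα hβ hγ (ind T)

/-- … and `R̃(T) = R̃(𝟙_{supp T})`. [cite: BlaserChristandlZuiddam2017, Lemma 3] -/
theorem asymptoticRank_eq_ind {T : Leaf2 → (Fin 2 × Fin 2) → Leaf2 → K} (hT : IsSpecial T) :
    asymptoticRank T = asymptoticRank (ind T) := by
  obtain ⟨hsub, hz⟩ := hT
  obtain ⟨α, β, γ, hα, hβ, hγ, hEq⟩ := exists_scale_ind hsub hz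
  conv_lhs => rw [hEq]
  exact asymptoticRank_scale_eq hα hβ hγ (ind T)

/-- A tensor with the same support as a special member is special. [folklore] -/
theorem isSpecial_of_support_iff {T T' : Leaf2 → (Fin 2 × Fin 2) → Leaf2 → K}
    (hT : IsSpecial T) (h : ∀ a x c, T a x c = 0 ↔ T' a x c = 0) : IsSpecial T' := by
  obtain ⟨hsub, a, x, c, hne, hz⟩ := hT
  exact ⟨fun a x c h1 => (h a x c).1 (hsub a x c h1), a, x, c, hne, (h a x c).1 hz⟩

/-- **Same support, same value**: two special members with the same support have the same
value under every universal spectral point (every field).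
[cite: BlaserChristandlZuiddam2017, Lemma 3] [cite: Strassen1988, §2] -/
theorem spectralPoint_eq_of_support_iff {Φ : SpectralMap K} (hΦ : IsUniversalSpectralPoint K Φ)
    {T T' : Leaf2 → (Fin 2 × Fin 2) → Leaf2 → K} (hT : IsSpecial T)
    (h : ∀ a x c, T a x c = 0 ↔ T' a x c = 0) : Φ T = Φ T' := by
  rw [spectralPoint_eq_ind hΦ hT, spectralPoint_eq_ind hΦ (isSpecial_of_support_iff hT h),
    ind_eq_of_support_iff h]

open Classical in
/-- The support of `T` as a `Finset` of positions. [folklore] -/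
def suppOf (T : Leaf2 → (Fin 2 × Fin 2) → Leaf2 → K) : Finset (Leaf2 × (Fin 2 × Fin 2) × Leaf2) :=
  Finset.univ.filter fun z => T z.1 z.2.1 z.2.2 ≠ 0

/-- Membership in `suppOf T`. [folklore] -/
theorem mem_suppOf (T : Leaf2 → (Fin 2 × Fin 2) → Leaf2 → K)
    (z : Leaf2 × (Fin 2 × Fin 2) × Leaf2) : z ∈ suppOf T ↔ T z.1 z.2.1 z.2.2 ≠ 0 := by
  simp [suppOf]

variable (K) in
/-- The `0/1` tensor `𝟙_W` of a set `W` of positions. [folklore] -/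
def indOf (W : Finset (Leaf2 × (Fin 2 × Fin 2) × Leaf2)) : Leaf2 → (Fin 2 × Fin 2) → Leaf2 → K :=
  fun a x c => if (a, x, c) ∈ W then 1 else 0

/-- `𝟙_{suppOf T} = 𝟙_{supp T}`. [folklore] -/
theorem indOf_suppOf (T : Leaf2 → (Fin 2 × Fin 2) → Leaf2 → K) : indOf K (suppOf T) = ind T := by
  funext a x c
  by_cases hz : T a x c = 0
  · rw [ind_apply_of_eq_zero hz]
    simp [indOf, mem_suppOf, hz]
  · rw [ind_apply_of_ne_zero hz]
    simp [indOf, mem_suppOf, hz]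

/-- **Finitely many special values**: under every universal spectral point the special class
takes at most `2^64` (in fact: number of proper sub-supports) values — every field.
[cite: BlaserChristandlZuiddam2017, Lemma 3] -/
theorem spectral_special_values_finite {Φ : SpectralMap K} (hΦ : IsUniversalSpectralPoint K Φ) :
    ((fun T => Φ T) '' {T : Leaf2 → (Fin 2 × Fin 2) → Leaf2 → K | IsSpecial T}).Finite := by
  refine (Set.finite_univ.image fun W : Finset (Leaf2 × (Fin 2 × Fin 2) × Leaf2) =>
    Φ (indOf K W)).subset ?_
  rintro _ ⟨T, hT, rfl⟩
  refine ⟨suppOf T, Set.mem_univ _, ?_⟩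
  show Φ (indOf K (suppOf T)) = Φ T
  rw [indOf_suppOf, ← spectralPoint_eq_ind hΦ hT]

open Classical in
/-- The eight support positions of `𝔖(1)` as a `Finset`. [cite: BlaserChristandlZuiddam2017, §2] -/
def suppS (K : Type) [Field K] : Finset (Leaf2 × (Fin 2 × Fin 2) × Leaf2) :=
  Finset.univ.filter fun z => fam K 1 z.1 z.2.1 z.2.2 ≠ 0

/-- Membership in `suppS`. [folklore] -/
theorem mem_suppS (z : Leaf2 × (Fin 2 × Fin 2) × Leaf2) :
    z ∈ suppS K ↔ fam K 1 z.1 z.2.1 z.2.2 ≠ 0 := by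
  simp [suppS]

/-- `𝟙_W` is special for every PROPER sub-support `W ⊊ supp 𝔖(1)`. [folklore] -/
theorem isSpecial_indOf {W : Finset (Leaf2 × (Fin 2 × Fin 2) × Leaf2)} (hW : W ⊆ suppS K)
    (hne : W ≠ suppS K) : IsSpecial (indOf K W) := by
  refine ⟨fun a x c h1 => ?_, ?_⟩
  · have hm : (a, x, c) ∉ W := fun hm => (mem_suppS _).1 (hW hm) h1
    simp [indOf, hm]
  · obtain ⟨z, hz, hzW⟩ := Finset.exists_of_ssubset (lt_of_le_of_ne hW hne)
    exact ⟨z.1, z.2.1, z.2.2, (mem_suppS z).1 hz, by simp [indOf, hzW]⟩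

/-! ## §4 Over an infinite field the support function is monotone -/

variable [Infinite K]

/-- **Monotonicity in the support**: if `T'` is special and `supp T ⊆ supp T'`, then
`Φ(T) ≤ Φ(T')` for every universal spectral point `Φ` (infinite field): the torus orbit of `T'`
is Zariski dense in the coordinate subspace `K^{supp T'}` (§2 + X-d density), on which `Φ` is
therefore capped by `Φ(T')` (closed sublevel sets, X-b).
[cite: ChristandlHoeberechtsNieuwboerVranaZuiddam2025, §3]
[cite: BlaserChristandlZuiddam2017, Lemma 3] -/
theorem spectralPoint_mono_support {Φ : SpectralMap K} (hΦ : IsUniversalSpectralPoint K Φ)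
    {T T' : Leaf2 → (Fin 2 × Fin 2) → Leaf2 → K} (hT' : IsSpecial T')
    (h : ∀ a x c, T' a x c = 0 → T a x c = 0) : Φ T ≤ Φ T' := by
  refine spectralPoint_le_of_zariski_sublevel hΦ _ T fun p hp => ?_
  have hsub : ∀ z, z ∉ suppOf T' → tensorEntries T z = 0 := fun z hz => by
    have hz' : T' z.1 z.2.1 z.2.2 = 0 := by
      by_contra hne
      exact hz ((mem_suppOf T' z).2 hne)
    exact h _ _ _ hz'
  refine eval_eq_zero_of_support_subset (suppOf T') p (fun y hy => ?_) (tensorEntries T) hsub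
  have hyT' : ∀ a x c, T' a x c = 0 ↔ (fun a x c => y (a, x, c)) a x c = 0 := fun a x c => by
    have hz := hy (a, x, c)
    rw [mem_suppOf] at hz
    constructor
    · intro h0
      by_contra hne'
      exact hz.1 hne' h0
    · intro h0
      by_contra hne'
      exact hz.2 hne' h0
  have hval : Φ (fun a b c => y (a, b, c)) = Φ T' :=
    (spectralPoint_eq_of_support_iff hΦ hT' hyT').symm
  have hte : tensorEntries (fun a b c => y (a, b, c)) = y := funext fun z => rfl
  have h' := hp (fun a b c => y (a, b, c)) (le_of_eq hval)
  rwa [hte] at h'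

/-- **Monotonicity of asymptotic rank in the support** on the special class (infinite field).
[cite: ChristandlHoeberechtsNieuwboerVranaZuiddam2025, Thm. 1.2] [cite: Strassen1988, Thm. 3.9] -/
theorem asymptoticRank_mono_support {T T' : Leaf2 → (Fin 2 × Fin 2) → Leaf2 → K}
    (hT' : IsSpecial T') (h : ∀ a x c, T' a x c = 0 → T a x c = 0) :
    asymptoticRank T ≤ asymptoticRank T' := by
  obtain ⟨Φ, hΦ, hΦT⟩ := (strassen_duality_asymptoticRank_holds K T).2
  rw [← hΦT]
  exact (spectralPoint_mono_support hΦ hT' h).trans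
    ((strassen_duality_asymptoticRank_holds K T').1 Φ hΦ)

/-- **Lattice form**: `W ⊆ W' ⊊ supp 𝔖(1) ⟹ Φ(𝟙_W) ≤ Φ(𝟙_{W'})` — on the special class every
universal spectral point is a monotone set function of the support (infinite field); its top
value, at the seven-point supports, is the special level `s = Φ(𝔖(0))` (XI-c).
[cite: ChristandlHoeberechtsNieuwboerVranaZuiddam2025, §3]
[cite: BlaserChristandlZuiddam2017, Lemma 3] -/
theorem spectralPoint_indOf_mono {Φ : SpectralMap K} (hΦ : IsUniversalSpectralPoint K Φ)
    {W W' : Finset (Leaf2 × (Fin 2 × Fin 2) × Leaf2)} (hWW' : W ⊆ W') (hW' : W' ⊆ suppS K)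
    (hne : W' ≠ suppS K) : Φ (indOf K W) ≤ Φ (indOf K W') :=
  spectralPoint_mono_support hΦ (isSpecial_indOf hW' hne) fun a x c h0 => by
    have hm : (a, x, c) ∉ W' := fun hm => by simp [indOf, hm] at h0
    have hmW : (a, x, c) ∉ W := fun hm' => hm (hWW' hm')
    simp [indOf, hmW]

/-- … and `R̃(𝟙_W) ≤ R̃(𝟙_{W'})`.
[cite: ChristandlHoeberechtsNieuwboerVranaZuiddam2025, Thm. 1.2] -/
theorem asymptoticRank_indOf_mono {W W' : Finset (Leaf2 × (Fin 2 × Fin 2) × Leaf2)}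
    (hWW' : W ⊆ W') (hW' : W' ⊆ suppS K) (hne : W' ≠ suppS K) :
    asymptoticRank (indOf K W) ≤ asymptoticRank (indOf K W') :=
  asymptoticRank_mono_support (isSpecial_indOf hW' hne) fun a x c h0 => by
    have hm : (a, x, c) ∉ W' := fun hm => by simp [indOf, hm] at h0
    have hmW : (a, x, c) ∉ W := fun hm' => hm (hWW' hm')
    simp [indOf, hmW]

end AnyField

end Summit.MatrixMultiplication.MatrixMultiplication.Theorems.FarEdgeDescentSupportLattice

end
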